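import Mathlib
import Summits.NavierStokesRegularity.NavierStokesRegularity.Theorems.EulerZoomLiouvillePowerGaugeEulerLiouvilleSelfSimilarDefectiveNodeThin
import Literature.Analysis.FluidPDE.SelfSimilarEulerOutgoing
import HarnessLib

/-!
# Rung C1 of the crux `EulerZoomLiouville.PowerGaugeEulerLiouville`: EVERY VORTICAL STAGNATION POINT IS THIN
# (route №10, item stmt-NavierStokesRegularity-19832; `--supports`)

Helper file (theorems only). Seat ns-typeII-p3 (cell ns-regularity-ideate §B, D-0081).  Sequel to
`…SelfSimilarDefectiveNodeThin`.  The exclusion theorems of this lineage (`eq_zero_of_driftCoordinate_of_…`) carry a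
hypothesis (ii): block data («thin shape») at every BAD stagnation point.  `…SelfSimilarNonVorticalBadNode` made
(ii) automatic at NON-vortical bad nodes (symmetric linearisation).  This file makes thinness automatic at every
VORTICAL stagnation point — bad or not, semisimple or not:

* `trace_eq_neg_charpoly_coeff_two`, `exists_quadraticCofactor` — for an operator `A` on `ℝ³` with a known
  eigenvector (`A om = λ₁ om`), Cayley–Hamilton in coordinates: `χ_A = (X − λ₁)(X² + uX + w)` with `u = λ₁ − tr A`,
  the operator identity `(A − λ₁)(A² + uA + w) = 0`, and an eigenvector for every real root of the cofactor
  (`Module.End.hasEigenvalue_iff_isRoot_charpoly`);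
* `exists_blockBasis_of_complexPair` — if `u² < 4w`, a real block basis `(b₀, −δ⁻¹(A + u/2)b₀, om)` with
  `A b₀ = (−u/2)b₀ − δb₁`, `A b₁ = δb₀ + (−u/2)b₁` (`δ = √(w − u²/4)`), built from any `b₀ ≠ 0` in `ker(A² + uA + w)`;
* **`exists_trappedSet_null_of_curl_ne_zero`** — `(V, P)` a classical self-similar profile, `V` smooth, `‖DV‖ ≤ K`,
  `−1 < γ < ½`, `z ∈ 𝒩_W` with `curl V z ≠ 0` ⇒ for some `T > 0`, `r > 0` the `Φ_T`-trapped set in `B(z, r)` is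
  NULL.  At such `z`, `A = γI + DV(z)` has `AΩ(z) = (1+γ)Ω(z)` (tree `fderiv_apply_curl_eq_of_mem_nodalSet`) and
  `tr A = 3γ`, so `u = 1 − 2γ > 0` and the cofactor's roots have real parts summing to `2γ − 1 < 0`; the four
  spectral cases are the four thin shapes: complex pair ⇒ `…_of_contractingPlane`; three distinct reals ⇒ eigenbasis
  ⇒ `…_of_dominatedBlock`; `r₂ = 1+γ` ⇒ `…_of_eigenline_lt_doubleRoot`; double root ⇒ `…_of_doubleRoot_lt_eigenline`
  (the last two cover DEFECTIVE linearisations).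

Consequence (next file): hypothesis (ii) disappears from the exclusion theorem — with (3.8) and `0 < γ < ½`, a drift
coordinate alone forces `V ≡ 0`; and the backward basin of the whole bad set is null unconditionally.

WHAT THIS IS NOT: not NS, not E, not rung C1 — the null-trapped-set statement at one vortical stagnation point of a
classical profile. [cite: ConstantinIgnatovaVicol2026Putative §3.4.1 (3.22); Robinson1999 Ch. V §5.10.1; Khalil2002 §4.3]
-/

noncomputable section

-- flat `Theorems/<Route><Decl>…` files of one crux share the namespace of the crux (tree convention)
set_option linter.dupNamespace false

open MeasureTheory Set Filter Topology Metric Function InnerProductSpace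
open scoped RealInnerProductSpace NNReal ContDiff

namespace Summit.NavierStokesRegularity.NavierStokesRegularity.Theorems.PowerGaugeEulerLiouville.Kelvin

open Literature.Analysis Literature.Analysis.FluidPDE Literature.Dynamics.FixedPoints

/-! ### Linear algebra on `ℝ³`: characteristic polynomial of an operator with a known eigenvector -/

section Spectral

/-- `tr f = −(coefficient of X² in χ_f)` for an endomorphism of `ℝ³`. [folklore] -/
theorem trace_eq_neg_charpoly_coeff_two
    (f : EuclideanSpace ℝ (Fin 3) →ₗ[ℝ] EuclideanSpace ℝ (Fin 3)) :
    LinearMap.trace ℝ (EuclideanSpace ℝ (Fin 3)) f = -f.charpoly.coeff 2 := by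
  set B := Module.finBasisOfFinrankEq ℝ (EuclideanSpace ℝ (Fin 3))
    (finrank_euclideanSpace_fin : Module.finrank ℝ (EuclideanSpace ℝ (Fin 3)) = 3)
  rw [LinearMap.trace_eq_matrix_trace ℝ B f, Matrix.trace_eq_neg_charpoly_coeff, Fintype.card_fin,
    f.charpoly_toMatrix B]

/-- **Cayley–Hamilton and the linear factor, in coordinates.**  Let `A` be an operator on `ℝ³` with an eigenvector
`om ≠ 0`, `Aom = λ₁om`.  Writing `χ_A = X³ + p₂X² + p₁X + p₀`, put `u = p₂ + λ₁`, `w = p₁ + λ₁u`; then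
`χ_A = (X − λ₁)(X² + uX + w)`, so that (i) `(A − λ₁)(A² + uA + w) = 0`, (ii) `u = λ₁ − tr A`, and (iii) every real
root `r` of `X² + uX + w` is an eigenvalue of `A`. [folklore] -/
theorem exists_quadraticCofactor (A : EuclideanSpace ℝ (Fin 3) →L[ℝ] EuclideanSpace ℝ (Fin 3))
    {om : EuclideanSpace ℝ (Fin 3)} (hom : om ≠ 0) {lam₁ : ℝ} (hAom : A om = lam₁ • om) :
    ∃ u w : ℝ, u = lam₁ - LinearMap.trace ℝ (EuclideanSpace ℝ (Fin 3))
        (A : EuclideanSpace ℝ (Fin 3) →ₗ[ℝ] EuclideanSpace ℝ (Fin 3)) ∧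
      (∀ x, A (A (A x) + u • A x + w • x) = lam₁ • (A (A x) + u • A x + w • x)) ∧
      ∀ r : ℝ, r ^ 2 + u * r + w = 0 → ∃ v : EuclideanSpace ℝ (Fin 3), v ≠ 0 ∧ A v = r • v := by
  set f : EuclideanSpace ℝ (Fin 3) →ₗ[ℝ] EuclideanSpace ℝ (Fin 3) :=
    (A : EuclideanSpace ℝ (Fin 3) →ₗ[ℝ] EuclideanSpace ℝ (Fin 3)) with hf
  set p : Polynomial ℝ := f.charpoly with hp
  have hp3 : p.natDegree = 3 := by rw [hp, LinearMap.charpoly_natDegree, finrank_euclideanSpace_fin]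
  have hmonic : p.Monic := LinearMap.charpoly_monic f
  have hc3 : p.coeff 3 = 1 := by
    have h := hmonic.coeff_natDegree; rwa [hp3] at h
  -- Cayley–Hamilton on vectors
  have hCH : ∀ x, A (A (A x)) + p.coeff 2 • A (A x) + p.coeff 1 • A x + p.coeff 0 • x = 0 := by
    intro x
    have h := LinearMap.aeval_self_charpoly f
    rw [Polynomial.aeval_eq_sum_range, ← hp, hp3] at h
    have hx := LinearMap.congr_fun h x
    simp only [Finset.sum_range_succ, Finset.sum_range_zero, zero_add, LinearMap.zero_apply, LinearMap.add_apply,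
      LinearMap.smul_apply, hc3, one_smul, pow_zero, pow_succ] at hx
    rw [← hx]
    simp only [hf]
    module
  -- `λ₁` is a root
  have hroot : lam₁ ^ 3 + p.coeff 2 * lam₁ ^ 2 + p.coeff 1 * lam₁ + p.coeff 0 = 0 := by
    have hev : Module.End.HasEigenvalue f lam₁ :=
      Module.End.hasEigenvalue_of_hasEigenvector ⟨Module.End.mem_eigenspace_iff.2 (by exact hAom), hom⟩
    have h := (Module.End.hasEigenvalue_iff_isRoot_charpoly f lam₁).1 hev
    rw [Polynomial.IsRoot.def, Polynomial.eval_eq_sum_range, ← hp, hp3] at h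
    simp only [Finset.sum_range_succ, Finset.sum_range_zero, zero_add, hc3, one_mul, pow_zero, mul_one] at h
    linarith
  refine ⟨p.coeff 2 + lam₁, p.coeff 1 + lam₁ * (p.coeff 2 + lam₁), ?_, fun x => ?_, fun r hr => ?_⟩
  · rw [trace_eq_neg_charpoly_coeff_two f]; ring
  · have hp0 : p.coeff 0 = -(lam₁ ^ 3 + p.coeff 2 * lam₁ ^ 2 + p.coeff 1 * lam₁) := by linarith
    have h := hCH x
    rw [hp0] at h
    rw [← sub_eq_zero]
    rw [← h]
    simp only [map_add, map_smul]
    module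
  · -- `r` is a root of `χ_A = (X − λ₁)(X² + uX + w)`, hence an eigenvalue
    have hr3 : p.IsRoot r := by
      rw [Polynomial.IsRoot.def, Polynomial.eval_eq_sum_range, hp3]
      simp only [Finset.sum_range_succ, Finset.sum_range_zero, zero_add, hc3, one_mul, pow_zero, mul_one]
      have hp0 : p.coeff 0 = -(lam₁ ^ 3 + p.coeff 2 * lam₁ ^ 2 + p.coeff 1 * lam₁) := by linarith
      rw [hp0]
      have : (r - lam₁) * (r ^ 2 + (p.coeff 2 + lam₁) * r + (p.coeff 1 + lam₁ * (p.coeff 2 + lam₁))) = 0 := by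
        rw [hr, mul_zero]
      nlinarith [this]
    have hev : Module.End.HasEigenvalue f r := (Module.End.hasEigenvalue_iff_isRoot_charpoly f r).2 hr3
    obtain ⟨v, hv⟩ := hev.exists_hasEigenvector
    exact ⟨v, hv.2, Module.End.mem_eigenspace_iff.1 hv.1⟩

/-- **Block basis for a complex pair.**  `A` on `ℝ³` with `A om = λ₁ om`, `om ≠ 0`; `b₀ ≠ 0` with
`A²b₀ + uAb₀ + wb₀ = 0` where `u² < 4w` (the quadratic factor has the complex roots `−u/2 ± iδ`,
`δ = √(w − u²/4) > 0`).  Then `(b₀, −δ⁻¹(A + u/2)b₀, om)` is a basis in which `A` has the real block form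
`A b₀ = (−u/2)b₀ − δb₁`, `A b₁ = δb₀ + (−u/2)b₁`, `A om = λ₁ om`. [folklore] -/
theorem exists_blockBasis_of_complexPair (A : EuclideanSpace ℝ (Fin 3) →L[ℝ] EuclideanSpace ℝ (Fin 3))
    {om : EuclideanSpace ℝ (Fin 3)} (hom : om ≠ 0) {lam₁ u w : ℝ} (hAom : A om = lam₁ • om)
    (huw : u ^ 2 < 4 * w) {b₀ : EuclideanSpace ℝ (Fin 3)} (hb₀ : b₀ ≠ 0)
    (hQ : A (A b₀) + u • A b₀ + w • b₀ = 0) :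
    ∃ (b : Module.Basis (Fin 3) ℝ (EuclideanSpace ℝ (Fin 3))) (δ : ℝ), 0 < δ ∧
      A (b 0) = (-(u / 2)) • b 0 - δ • b 1 ∧ A (b 1) = δ • b 0 + (-(u / 2)) • b 1 ∧ A (b 2) = lam₁ • b 2 := by
  have hd0 : 0 < w - u ^ 2 / 4 := by linarith
  set δ : ℝ := Real.sqrt (w - u ^ 2 / 4) with hδ
  have hδ0 : 0 < δ := Real.sqrt_pos.2 hd0
  have hδne : δ ≠ 0 := hδ0.ne'
  have hδ2 : δ * δ = w - u ^ 2 / 4 := by rw [hδ]; exact Real.mul_self_sqrt hd0.le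
  have hw : w = δ * δ + u ^ 2 / 4 := by linarith
  -- `J = A + (u/2)`, `J²b₀ = −δ²b₀`
  have hJJ : A (A b₀ + (u / 2) • b₀) + (u / 2) • (A b₀ + (u / 2) • b₀) = -(δ * δ) • b₀ := by
    rw [hw] at hQ
    rw [← sub_eq_zero, ← hQ]
    simp only [map_add, map_smul]
    module
  set b₁ : EuclideanSpace ℝ (Fin 3) := -(δ⁻¹ • (A b₀ + (u / 2) • b₀)) with hb₁
  have hcancel : ∀ {x y : EuclideanSpace ℝ (Fin 3)}, δ • x = δ • y → x = y :=
    fun h => smul_right_injective _ hδne h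
  have e1 : δ • b₁ = -(A b₀ + (u / 2) • b₀) := by
    rw [hb₁, smul_neg, smul_smul, mul_inv_cancel₀ hδne, one_smul]
  clear_value b₁
  -- the block relations
  have hA0 : A b₀ = (-(u / 2)) • b₀ - δ • b₁ := by rw [e1]; module
  have hJb₁ : A b₁ + (u / 2) • b₁ = δ • b₀ := by
    apply hcancel
    have h1 : δ • (A b₁ + (u / 2) • b₁) = A (δ • b₁) + (u / 2) • (δ • b₁) := by
      rw [map_smul]; module
    rw [h1, e1, map_neg, smul_neg, ← neg_add, hJJ]
    module
  have hA1 : A b₁ = δ • b₀ + (-(u / 2)) • b₁ := by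
    rw [← hJb₁]; module
  -- linear independence of `(b₀, b₁, om)`
  have hQb₁ : A (A b₁) + u • A b₁ + w • b₁ = 0 := by
    apply hcancel
    rw [smul_zero]
    have h1 : δ • (A (A b₁) + u • A b₁ + w • b₁) = A (A (δ • b₁)) + u • A (δ • b₁) + w • (δ • b₁) := by
      simp only [map_smul]; module
    rw [h1, e1]
    have h2 : A (A (-(A b₀ + (u / 2) • b₀))) + u • A (-(A b₀ + (u / 2) • b₀)) + w • -(A b₀ + (u / 2) • b₀) =
        -(A (A (A b₀) + u • A b₀ + w • b₀)) - (u / 2) • (A (A b₀) + u • A b₀ + w • b₀) := by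
      simp only [map_add, map_smul, map_neg]; module
    rw [h2, hQ, map_zero, neg_zero, smul_zero, sub_zero]
  have hQom : A (A om) + u • A om + w • om = (lam₁ ^ 2 + u * lam₁ + w) • om := by
    rw [hAom, map_smul, hAom]; module
  have hqpos : 0 < lam₁ ^ 2 + u * lam₁ + w := by nlinarith [sq_nonneg (lam₁ + u / 2)]
  have hli : LinearIndependent ℝ ![b₀, b₁, om] := by
    rw [Fintype.linearIndependent_iff]
    intro g hg
    rw [Fin.sum_univ_three] at hg
    simp only [Matrix.cons_val_zero, Matrix.cons_val_one, Matrix.cons_val_two, Matrix.head_cons,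
      Matrix.tail_cons] at hg
    -- apply `Q`: `g₂ = 0`
    have h2 : g 2 = 0 := by
      have h := congrArg (fun x => A (A x) + u • A x + w • x) hg
      simp only [map_add, map_smul, map_zero, smul_zero, add_zero] at h
      have h' : g 0 • (A (A b₀) + u • A b₀ + w • b₀) + g 1 • (A (A b₁) + u • A b₁ + w • b₁) +
          g 2 • (A (A om) + u • A om + w • om) = 0 := by
        rw [← h]; module
      rw [hQ, hQb₁, hQom, smul_zero, smul_zero, zero_add, zero_add, smul_smul, smul_eq_zero] at h'
      rcases h' with h' | h'
      · exact (mul_eq_zero.1 h').resolve_right hqpos.ne'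
      · exact absurd h' hom
    rw [h2, zero_smul, add_zero] at hg
    -- apply `J`: `g₁ b₀ − g₀ b₁ = 0`
    have hJ : g 1 • b₀ - g 0 • b₁ = 0 := by
      apply hcancel
      rw [smul_zero]
      have h := congrArg (fun x => A x + (u / 2) • x) hg
      simp only [map_add, map_smul, map_zero, smul_zero, add_zero] at h
      have h' : g 0 • (A b₀ + (u / 2) • b₀) + g 1 • (A b₁ + (u / 2) • b₁) = 0 := by rw [← h]; module
      rw [hJb₁, ← neg_neg (A b₀ + (u / 2) • b₀), ← e1] at h'
      rw [← h']
      module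
    have hsq : (g 0 ^ 2 + g 1 ^ 2) • b₀ = 0 := by
      have h : (g 0 ^ 2 + g 1 ^ 2) • b₀ = g 0 • (g 0 • b₀ + g 1 • b₁) + g 1 • (g 1 • b₀ - g 0 • b₁) := by module
      rw [h, hg, hJ, smul_zero, smul_zero, add_zero]
    have hgg : g 0 ^ 2 + g 1 ^ 2 = 0 := (smul_eq_zero.1 hsq).resolve_right hb₀
    have hg0 : g 0 = 0 := pow_eq_zero_iff (n := 2) two_ne_zero |>.1 (by nlinarith [sq_nonneg (g 0), sq_nonneg (g 1)])
    have hg1 : g 1 = 0 := pow_eq_zero_iff (n := 2) two_ne_zero |>.1 (by nlinarith [sq_nonneg (g 0), sq_nonneg (g 1)])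
    intro i
    fin_cases i
    · exact hg0
    · exact hg1
    · exact h2
  have hcard : Fintype.card (Fin 3) = Module.finrank ℝ (EuclideanSpace ℝ (Fin 3)) := by
    rw [Fintype.card_fin, finrank_euclideanSpace_fin]
  set b := basisOfLinearIndependentOfCardEqFinrank hli hcard with hbdef
  have hb : ⇑b = ![b₀, b₁, om] := coe_basisOfLinearIndependentOfCardEqFinrank hli hcard
  have hb0 : b 0 = b₀ := by rw [hb]; rfl
  have hb1 : b 1 = b₁ := by rw [hb]; rfl
  have hb2 : b 2 = om := by rw [hb]; rfl
  refine ⟨b, δ, hδ0, ?_, ?_, ?_⟩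
  · rw [hb0, hb1]; exact hA0
  · rw [hb0, hb1]; exact hA1
  · rw [hb2]; exact hAom

end Spectral

variable {γ : ℝ} {V : EuclideanSpace ℝ (Fin 3) → EuclideanSpace ℝ (Fin 3)} {P : EuclideanSpace ℝ (Fin 3) → ℝ}

/-! ### Every vortical stagnation point is thin -/

/-- **EVERY VORTICAL STAGNATION POINT IS THIN.**  Let `(V, P)` be a classical self-similar Euler profile with `V`
smooth, `‖DV‖ ≤ K`, `−1 < γ < ½`, and let `z ∈ 𝒩_W` be a stagnation point of `W = γy + V` with `Ω(z) = curl V(z) ≠ 0`.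
Then for some sampling time `T > 0` and radius `r > 0` the set of points admitting a `Φ_T`-past history inside
`B(z, r)` is Lebesgue-null — with NO hypothesis on the linearisation.  Proof: `A = DW(z) = γI + DV(z)` has
`AΩ(z) = (1+γ)Ω(z)` (CIV (3.24) frozen at the node) and `tr A = 3γ`, so `χ_A = (X − (1+γ))(X² + uX + w)` with
`u = 1 − 2γ > 0`; the four spectral cases (complex pair / three distinct reals / `r₂ = 1+γ` / double root, the last
two possibly defective) are the four thin shapes `…_of_contractingPlane`, `…_of_dominatedBlock`,
`…_of_eigenline_lt_doubleRoot`, `…_of_doubleRoot_lt_eigenline`.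
[cite: ConstantinIgnatovaVicol2026Putative, §3.4.1 eq. (3.22)/(3.24) (vorticity eigen-relation at a node); Robinson1999, Ch. V §5.10.1 (cone estimate, dominated form; proved in the tree)] -/
theorem exists_trappedSet_null_of_curl_ne_zero (hV : ContDiff ℝ ∞ V) {K : ℝ} (hK : ∀ y, ‖fderiv ℝ V y‖ ≤ K)
    (hprof : IsSelfSimilarEulerProfile γ 0 V P) (hγ1 : -1 < γ) (hγ2 : γ < 1 / 2)
    {z : EuclideanSpace ℝ (Fin 3)} (hz : z ∈ selfSimilarNodalSet γ 0 V) (hcurl : curl V z ≠ 0) :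
    ∃ T : ℝ, 0 < T ∧ ∃ r : ℝ, 0 < r ∧ volume {q : EuclideanSpace ℝ (Fin 3) | ∃ qs : ℕ → EuclideanSpace ℝ (Fin 3),
      qs 0 = q ∧ (∀ k, ODE.evolutionMap (fun _ : ℝ => selfSimilarTransport γ 0 V) 0 T (qs (k + 1)) = qs k) ∧
        ∀ k, qs k ∈ ball z r} = 0 := by
  set A : EuclideanSpace ℝ (Fin 3) →L[ℝ] EuclideanSpace ℝ (Fin 3) :=
    γ • ContinuousLinearMap.id ℝ (EuclideanSpace ℝ (Fin 3)) + fderiv ℝ V z with hA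
  -- the eigen-relation `AΩ = (1+γ)Ω` and the trace
  have hAom : A (curl V z) = (1 + γ) • curl V z := by
    have h := hprof.isSelfSimilarEulerVorticityProfile.fderiv_apply_curl_eq_of_mem_nodalSet hz
    rw [show A (curl V z) = γ • curl V z + fderiv ℝ V z (curl V z) from rfl, h]
    module
  have htr : LinearMap.trace ℝ _ (A : EuclideanSpace ℝ (Fin 3) →ₗ[ℝ] EuclideanSpace ℝ (Fin 3)) = 3 * γ := by
    have hd : LinearMap.trace ℝ _ (fderiv ℝ V z : EuclideanSpace ℝ (Fin 3) →ₗ[ℝ] EuclideanSpace ℝ (Fin 3)) = 0 :=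
      hprof.divFree z
    rw [hA, ContinuousLinearMap.toLinearMap_add, ContinuousLinearMap.toLinearMap_smul, map_add, map_smul, hd,
      add_zero, ContinuousLinearMap.coe_id, LinearMap.trace_id, finrank_euclideanSpace, Fintype.card_fin, smul_eq_mul]
    push_cast
    ring
  obtain ⟨u, w, hu, hQ, hroots⟩ := exists_quadraticCofactor A hcurl hAom
  have hu' : u = 1 - 2 * γ := by rw [hu, htr]; ring
  have hu0 : 0 < u := by rw [hu']; linarith
  have hlam : 0 < 1 + γ := by linarith
  -- `A` is not the scalar `1+γ`
  have hne : ∃ x : EuclideanSpace ℝ (Fin 3), A x ≠ (1 + γ) • x := by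
    by_contra h
    push Not at h
    have hAeq : (A : EuclideanSpace ℝ (Fin 3) →ₗ[ℝ] EuclideanSpace ℝ (Fin 3)) = (1 + γ) • LinearMap.id := by
      apply LinearMap.ext; intro x; exact h x
    have htr' := htr
    rw [hAeq, map_smul, LinearMap.trace_id, finrank_euclideanSpace, Fintype.card_fin, smul_eq_mul] at htr'
    push_cast at htr'
    linarith
  -- `ker(A² + uA + w) ≠ 0`
  have hb₀ : ∃ b₀ : EuclideanSpace ℝ (Fin 3), b₀ ≠ 0 ∧ A (A b₀) + u • A b₀ + w • b₀ = 0 := by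
    by_contra h
    push Not at h
    set Q : EuclideanSpace ℝ (Fin 3) →ₗ[ℝ] EuclideanSpace ℝ (Fin 3) :=
      ((A * A + u • A + w • 1 : EuclideanSpace ℝ (Fin 3) →L[ℝ] EuclideanSpace ℝ (Fin 3)) :
        EuclideanSpace ℝ (Fin 3) →ₗ[ℝ] EuclideanSpace ℝ (Fin 3)) with hQdef
    have hQapp : ∀ x, Q x = A (A x) + u • A x + w • x := fun x => rfl
    have hinj : Function.Injective Q := by
      rw [← LinearMap.ker_eq_bot, Submodule.eq_bot_iff]
      intro x hx
      rw [LinearMap.mem_ker, hQapp] at hx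
      by_contra hx0
      exact h x hx0 hx
    obtain ⟨x, hx⟩ := hne
    obtain ⟨y, rfl⟩ := (LinearMap.injective_iff_surjective.1 hinj) x
    exact hx (by rw [hQapp]; exact hQ y)
  rcases lt_or_ge (u ^ 2) (4 * w) with hdisc | hdisc
  · -- complex pair: contracting plane dominated by the vortical eigenline
    obtain ⟨b₀, hb₀ne, hQb₀⟩ := hb₀
    obtain ⟨b, δ, hδ, hA0, hA1, hA2⟩ := exists_blockBasis_of_complexPair A hcurl hAom hdisc hb₀ne hQb₀
    refine exists_trappedSet_null_of_contractingPlane hV hK hz b ![-(u / 2), -(u / 2), 1 + γ] δ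
      (by exact hA0) (by exact hA1) (by exact hA2) ?_ ?_ ?_ ?_
    · change -(u / 2) < 0; linarith
    · change -(u / 2) < 0; linarith
    · change -(u / 2) < 1 + γ; linarith
    · change -(u / 2) < 1 + γ; linarith
  · -- real roots `r₁ ≤ r₂` of the quadratic factor
    set D : ℝ := u ^ 2 - 4 * w with hD
    have hD0 : 0 ≤ D := by rw [hD]; linarith
    set r₁ : ℝ := (-u - Real.sqrt D) / 2 with hr₁
    set r₂ : ℝ := (-u + Real.sqrt D) / 2 with hr₂
    have hsD := Real.sq_sqrt hD0
    have hsD0 := Real.sqrt_nonneg D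
    have hsum : r₁ + r₂ = -u := by rw [hr₁, hr₂]; ring
    have hprod : r₁ * r₂ = w := by
      rw [hr₁, hr₂]
      nlinarith [hsD]
    have hr₁0 : r₁ < 0 := by rw [hr₁]; nlinarith
    have hr₁1 : r₁ < 1 + γ := by linarith
    have hroot₁ : r₁ ^ 2 + u * r₁ + w = 0 := by linear_combination r₁ * hsum - hprod
    have hroot₂ : r₂ ^ 2 + u * r₂ + w = 0 := by linear_combination r₂ * hsum - hprod
    obtain ⟨v₁, hv₁, hAv₁⟩ := hroots r₁ hroot₁
    by_cases h2 : r₂ = 1 + γ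
    · -- `χ_A = (X − r₁)(X − (1+γ))²`: eigenline below a (possibly defective) double root
      refine exists_trappedSet_null_of_eigenline_lt_doubleRoot hV hK hz hv₁ hAv₁ hr₁0 hr₁1 (fun x => ?_)
      have hux : u = -(r₁ + (1 + γ)) := by rw [← h2]; linarith
      have hwx : w = r₁ * (1 + γ) := by rw [← h2, hprod]
      have h := hQ x
      rw [hux, hwx] at h
      change A (A (A x - (1 + γ) • x) - (1 + γ) • (A x - (1 + γ) • x)) =
        r₁ • (A (A x - (1 + γ) • x) - (1 + γ) • (A x - (1 + γ) • x))
      rw [← sub_eq_zero]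
      have h' : A (A (A x) + -(r₁ + (1 + γ)) • A x + (r₁ * (1 + γ)) • x) -
          (1 + γ) • (A (A x) + -(r₁ + (1 + γ)) • A x + (r₁ * (1 + γ)) • x) = 0 := sub_eq_zero.2 h
      rw [← h']
      simp only [map_add, map_sub, map_smul]
      module
    · by_cases h12 : D = 0
      · -- `χ_A = (X − (1+γ))(X − r₁)²`: a (possibly defective) double root below the vortical eigenline
        have hr12 : r₂ = r₁ := by rw [hr₁, hr₂, h12, Real.sqrt_zero]; ring
        refine exists_trappedSet_null_of_doubleRoot_lt_eigenline hV hK hz hr₁0 hr₁1 hne (fun x => ?_)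
        have hux : u = -(2 * r₁) := by rw [hr12] at hsum; linarith
        have hwx : w = r₁ * r₁ := by rw [← hprod, hr12]
        have h := hQ x
        rw [hux, hwx] at h
        change A (A (A x - r₁ • x) - r₁ • (A x - r₁ • x)) = (1 + γ) • (A (A x - r₁ • x) - r₁ • (A x - r₁ • x))
        rw [← sub_eq_zero]
        have h' : A (A (A x) + -(2 * r₁) • A x + (r₁ * r₁) • x) -
            (1 + γ) • (A (A x) + -(2 * r₁) • A x + (r₁ * r₁) • x) = 0 := sub_eq_zero.2 h
        rw [← h']
        simp only [map_add, map_sub, map_smul]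
        module
      · -- three distinct real eigenvalues `r₁ < r₂`, `1 + γ`: an eigenbasis, contracting line
        have hDpos : 0 < D := lt_of_le_of_ne hD0 (Ne.symm h12)
        have hsDpos : 0 < Real.sqrt D := Real.sqrt_pos.2 hDpos
        have hr12 : r₁ < r₂ := by rw [hr₁, hr₂]; linarith
        obtain ⟨v₂, hv₂, hAv₂⟩ := hroots r₂ hroot₂
        have hinj : Function.Injective ![r₂, 1 + γ, r₁] := by
          intro i j hij
          fin_cases i <;> fin_cases j <;> simp at hij ⊢ <;> first | linarith | exact h2 hij | exact h2 hij.symm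
        have hli : LinearIndependent ℝ ![v₂, curl V z, v₁] := by
          refine Module.End.eigenvectors_linearIndependent'
            (A : EuclideanSpace ℝ (Fin 3) →ₗ[ℝ] EuclideanSpace ℝ (Fin 3)) ![r₂, 1 + γ, r₁] hinj _ (fun i => ?_)
          fin_cases i
          · exact ⟨Module.End.mem_eigenspace_iff.2 (by exact hAv₂), hv₂⟩
          · exact ⟨Module.End.mem_eigenspace_iff.2 (by exact hAom), hcurl⟩
          · exact ⟨Module.End.mem_eigenspace_iff.2 (by exact hAv₁), hv₁⟩
        have hcard : Fintype.card (Fin 3) = Module.finrank ℝ (EuclideanSpace ℝ (Fin 3)) := by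
          rw [Fintype.card_fin, finrank_euclideanSpace_fin]
        set b := basisOfLinearIndependentOfCardEqFinrank hli hcard with hbdef
        have hb : ⇑b = ![v₂, curl V z, v₁] := coe_basisOfLinearIndependentOfCardEqFinrank hli hcard
        have hb0 : b 0 = v₂ := by rw [hb]; rfl
        have hb1 : b 1 = curl V z := by rw [hb]; rfl
        have hb2 : b 2 = v₁ := by rw [hb]; rfl
        refine exists_trappedSet_null_of_dominatedBlock hV hK hz b ![r₂, 1 + γ, r₁] 0 ?_ ?_ ?_ ?_ ?_ ?_
        · rw [hb0, hb1, zero_smul, sub_zero]; exact hAv₂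
        · rw [hb0, hb1, zero_smul, zero_add]; exact hAom
        · rw [hb2]; exact hAv₁
        · exact hr₁0
        · exact hr12
        · exact hr₁1

end Summit.NavierStokesRegularity.NavierStokesRegularity.Theorems.PowerGaugeEulerLiouville.Kelvin

end
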